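import Literature.AlgebraicGeometry.Resolution.DiffOpCoordinateSpan
import Literature.AlgebraicGeometry.Resolution.HasseSystemOfFormallySmooth
import Literature.AlgebraicGeometry.Resolution.DiffIdealLocalizationGeneral
import Mathlib.RingTheory.Smooth.StandardSmoothOfFree
import Mathlib.RingTheory.Kaehler.JacobiZariski
import Mathlib.RingTheory.Kaehler.Polynomial
import Mathlib.LinearAlgebra.TensorProduct.Basis
import Mathlib.RingTheory.LocalProperties.Basic
import HarnessLib

/-!
# The Leibniz inclusion `Diff^{≤ n}(I·J) ⊆ Σ_{i+j=n} Diff^{≤ i}(I)·Diff^{≤ j}(J)` on smooth algebras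

For Grothendieck's differential operators (`DifferentialOperators.lean`: `IsDiffOpLE`, `diffIdeal`, EGA IV₄ 16.8)
the product rule `Diff^{≤ n}(I·J) ⊆ Σ_{i ≤ n} Diff^{≤ i}(I) · Diff^{≤ n−i}(J)` is FALSE for singular algebras (on
the node `K[s,t]/(st)` every operator preserves `𝔪 = (s,t)`, while `s∂_s²(s²) = 2s ∉ 𝔪²`) but holds on smooth
algebras over a field, where `Diff^{≤ n}` is locally spanned by divided partial derivatives along étale
coordinates (EGA IV₄ 16.11.2). This file proves it:

* `derivation_eq_zero_of_basis_kaehlerDifferential`, `formallySmooth_mvPolynomial_of_basis_kaehlerDifferential` —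
  if `Ω[B⁄k]` has a basis `d y_i` (`i ∈ ι` finite) and `H¹(L_{B/k}) = 0`, then `B` is unramified and formally
  smooth over `k[X_i] → B`, `X_i ↦ y_i` (Jacobi–Zariski);
* `diffIdeal_mul_le_of_basis_kaehlerDifferential` — the Leibniz inclusion for such `B`
  (`HasseSystemOfFormallySmooth` + `DiffOpCoordinateSpan`);
* `diffIdeal_mul_le_of_isStandardSmooth` — for standard smooth algebras (Mathlib:
  `IsStandardSmooth.iff_exists_basis_kaehlerDifferential`);
* `diffIdeal_mul_le_of_smooth` — **for every smooth algebra over a field**, by the standard-smooth cover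
  (`Algebra.Smooth.exists_span_eq_top_isStandardSmooth`) and the compatibility of `Diff^{≤ n}(I)` with
  localization (`map_diffIdeal_eq_of_isLocalization`).

Consumer: Hironaka 2017 ms. Lem. 4.2 (campaign res-hironaka, lane HIRONAKA-L, FACT-INDEX C-01); nothing of that
manuscript is used or asserted here.

## References

* [EGAIV4] A. Grothendieck, J. Dieudonné, ÉGA IV₄, Publ. Math. IHÉS 32 (1967), Thm. 16.11.2, Cor. 16.11.3,
  Prop. 16.8.6, Prop. 16.8.8; Prop. 17.2.3 (smooth ⇒ locally étale coordinates).
* [VillamayorU2008ReesDiff] O. Villamayor U., *Rees algebras on smooth schemes: integral closure and higher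
  differential operators*, Rev. Mat. Iberoam. 24 (2008), §2.6 and §3 (Leibniz for Δ^α on smooth schemes).
-/

open scoped BigOperators TensorProduct
open MvPolynomial KaehlerDifferential

namespace Literature.AlgebraicGeometry.Resolution

universe u v

section Coordinates

variable (k : Type*) [CommRing k] {B : Type*} [CommRing B] [Algebra k B]
variable {ι : Type*}

/-- If `Ω[B⁄k]` has a basis of the form `(d y_i)_i`, a `k`-derivation of `B` into itself which kills every
`y_i` is zero. [cite: EGAIV4, Cor. 16.11.3 (with 16.5.?: derivations factor through Ω¹, which is free on the dz_i)] -/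
theorem derivation_eq_zero_of_basis_kaehlerDifferential (b : Module.Basis ι B Ω[B⁄k]) (y : ι → B)
    (hb : ∀ i, b i = D k B (y i)) (δ : Derivation k B B) (hδ : ∀ i, δ (y i) = 0) : δ = 0 := by
  have hL : δ.liftKaehlerDifferential = 0 := by
    refine b.ext fun i => ?_
    rw [hb, Derivation.liftKaehlerDifferential_comp_D, hδ, LinearMap.zero_apply]
  refine Derivation.ext fun x => ?_
  have h := δ.liftKaehlerDifferential_comp_D x
  rw [hL, LinearMap.zero_apply] at h
  rw [← h, Derivation.zero_apply]

/-- If `Ω[B⁄k]` has a basis `(d y_i)_{i ∈ ι}` and `H¹(L_{B/k}) = 0`, then `B` is **formally smooth over the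
polynomial ring `k[X_i : i ∈ ι]`** mapping `X_i ↦ y_i` (indeed formally étale: `Ω[B⁄k[X]] = 0` and, by the
Jacobi–Zariski sequence `H¹(L_{B/k}) → H¹(L_{B/k[X]}) → B ⊗ Ω[k[X]⁄k] → Ω[B⁄k]`, whose last map sends the
basis `1 ⊗ dX_i` to the basis `d y_i`, also `H¹(L_{B/k[X]}) = 0`).
[cite: EGAIV4, Cor. 17.15.? / Thm. 16.11.2 setting (Ω¹ free on dz_i ⇒ (z_i) formally étale over 𝔸ⁿ); cf. Prop. 17.2.3] -/
theorem formallySmooth_mvPolynomial_of_basis_kaehlerDifferential [Subsingleton (Algebra.H1Cotangent k B)]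
    (b : Module.Basis ι B Ω[B⁄k]) (y : ι → B) (hb : ∀ i, b i = D k B (y i))
    [Algebra (MvPolynomial ι k) B] [IsScalarTower k (MvPolynomial ι k) B]
    (hy : ∀ i, algebraMap (MvPolynomial ι k) B (X i) = y i) :
    Algebra.FormallySmooth (MvPolynomial ι k) B := by
  -- `Ω[B / k[X]] = 0`
  have hmap : KaehlerDifferential.map k (MvPolynomial ι k) B B = 0 := by
    refine b.ext fun i => ?_
    rw [hb, KaehlerDifferential.map_D, LinearMap.zero_apply, ← hy, ← IsScalarTower.algebraMap_apply,
      Derivation.map_algebraMap]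
  have hΩ : Subsingleton Ω[B⁄MvPolynomial ι k] := by
    refine ⟨fun ω ω' => ?_⟩
    obtain ⟨a, rfl⟩ := KaehlerDifferential.map_surjective k (MvPolynomial ι k) B ω
    obtain ⟨a', rfl⟩ := KaehlerDifferential.map_surjective k (MvPolynomial ι k) B ω'
    rw [hmap, LinearMap.zero_apply, LinearMap.zero_apply]
  haveI : Module.Free B Ω[B⁄MvPolynomial ι k] := Module.Free.of_subsingleton B _
  -- `B ⊗ Ω[k[X]⁄k] → Ω[B⁄k]` is an isomorphism (basis to basis), in particular injective
  have hinj : Function.Injective (KaehlerDifferential.mapBaseChange k (MvPolynomial ι k) B) := by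
    let bT : Module.Basis ι B (B ⊗[MvPolynomial ι k] Ω[MvPolynomial ι k⁄k]) :=
      (KaehlerDifferential.mvPolynomialBasis k ι).baseChange B
    have heq : KaehlerDifferential.mapBaseChange k (MvPolynomial ι k) B = (bT.equiv b (Equiv.refl ι)).toLinearMap := by
      refine bT.ext fun i => ?_
      rw [LinearEquiv.coe_toLinearMap, Module.Basis.equiv_apply, Equiv.refl_apply, hb]
      change KaehlerDifferential.mapBaseChange k (MvPolynomial ι k) B
        (((KaehlerDifferential.mvPolynomialBasis k ι).baseChange B) i) = _
      rw [Module.Basis.baseChange_apply, KaehlerDifferential.mvPolynomialBasis_apply,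
        KaehlerDifferential.mapBaseChange_tmul, one_smul, KaehlerDifferential.map_D, hy]
    rw [heq]
    exact (bT.equiv b (Equiv.refl ι)).injective
  -- Jacobi–Zariski: `H¹(L_{B/k[X]}) = 0`
  have hH1 : Subsingleton (Algebra.H1Cotangent (MvPolynomial ι k) B) := by
    refine ⟨fun z z' => ?_⟩
    have hδ0 : ∀ w, Algebra.H1Cotangent.δ k (MvPolynomial ι k) B w = 0 := fun w =>
      hinj (by
        rw [map_zero]
        exact (Algebra.H1Cotangent.exact_δ_mapBaseChange k (MvPolynomial ι k) B).apply_apply_eq_zero w)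
    have hδinj : ∀ w, Algebra.H1Cotangent.δ k (MvPolynomial ι k) B w = 0 → w = 0 := by
      intro w hw
      obtain ⟨v, rfl⟩ := ((Algebra.H1Cotangent.exact_map_δ k (MvPolynomial ι k) B) w).mp hw
      rw [Subsingleton.elim v 0, map_zero]
    rw [hδinj z (hδ0 z), hδinj z' (hδ0 z')]
  exact (Algebra.formallySmooth_iff _ _).mpr ⟨inferInstance, hH1⟩

/-- **The Leibniz inclusion for algebras with global coordinates**: if `Ω[B⁄k]` has a basis `(d y_i)_{i ∈ ι}`,
`ι` finite, and `H¹(L_{B/k}) = 0`, then `Diff^{≤ n}(I·J) ⊆ Σ_{i ≤ n} Diff^{≤ i}(I)·Diff^{≤ n−i}(J)` for all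
ideals `I, J ⊆ B` (Hasse–Schmidt system along `y` from formal smoothness over `k[X]`, then
`diffIdeal_mul_le_of_hasseSystem`). [cite: EGAIV4, Thm. 16.11.2]
[cite: VillamayorU2008ReesDiff, §3 (proof of Thm. 3.4: Δ^α(a·H) = Σ Δ^{α₁}(a) Δ^{α₂}(H))] -/
theorem diffIdeal_mul_le_of_basis_kaehlerDifferential [Fintype ι] [DecidableEq ι]
    [Subsingleton (Algebra.H1Cotangent k B)]
    (b : Module.Basis ι B Ω[B⁄k]) (y : ι → B) (hb : ∀ i, b i = D k B (y i)) (n : ℕ) (I J : Ideal B) :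
    diffIdeal k n (I * J) ≤ ⨆ (i : ℕ) (_ : i ≤ n), diffIdeal k i I * diffIdeal k (n - i) J := by
  letI alg : Algebra (MvPolynomial ι k) B := (MvPolynomial.aeval y).toRingHom.toAlgebra
  have hy : ∀ i, algebraMap (MvPolynomial ι k) B (X i) = y i := fun i => MvPolynomial.aeval_X y i
  haveI : IsScalarTower k (MvPolynomial ι k) B :=
    IsScalarTower.of_algebraMap_eq fun r => by
      change algebraMap k B r = MvPolynomial.aeval y (algebraMap k (MvPolynomial ι k) r)
      rw [MvPolynomial.algebraMap_eq, MvPolynomial.aeval_C]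
  haveI : Algebra.FormallySmooth (MvPolynomial ι k) B :=
    formallySmooth_mvPolynomial_of_basis_kaehlerDifferential k b y hb hy
  obtain ⟨Δ, h0, hmul, hself, hzero⟩ := exists_hasseSystem_of_formallySmooth k (B := B) (ι := ι) n
  simp only [hy] at hself hzero
  exact diffIdeal_mul_le_of_hasseSystem k (derivation_eq_zero_of_basis_kaehlerDifferential k b y hb)
    h0 hmul hself hzero I J

end Coordinates

section Smooth

/-- **The Leibniz inclusion on standard smooth algebras** (`Ω` free on some `d y_i`, `H¹ = 0`).
[cite: EGAIV4, Thm. 16.11.2 (with Prop. 17.2.3: standard smooth ⇒ étale coordinates)] -/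
theorem diffIdeal_mul_le_of_isStandardSmooth (k : Type u) [CommRing k] {B : Type v} [CommRing B] [Algebra k B]
    [Algebra.IsStandardSmooth k B] (n : ℕ) (I J : Ideal B) :
    diffIdeal k n (I * J) ≤ ⨆ (i : ℕ) (_ : i ≤ n), diffIdeal k i I * diffIdeal k (n - i) J := by
  classical
  rcases subsingleton_or_nontrivial B with hB | hB
  · intro z _; rw [Subsingleton.elim z 0]; exact zero_mem _
  obtain ⟨hH1, I₀, b, hb⟩ :=
    (Algebra.IsStandardSmooth.iff_exists_basis_kaehlerDifferential (R := k) (S := B)).mp inferInstance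
  have hfin : Finite I₀ := Module.Finite.finite_basis b
  letI : Fintype I₀ := Fintype.ofFinite I₀
  have hy : ∀ i : I₀, ∃ y : B, D k B y = b i := fun i => hb ⟨i, rfl⟩
  choose y hy using hy
  exact diffIdeal_mul_le_of_basis_kaehlerDifferential k b y (fun i => (hy i).symm) n I J

/-- **The Leibniz inclusion `Diff^{≤ n}(I·J) ⊆ Σ_{i ≤ n} Diff^{≤ i}(I) · Diff^{≤ n−i}(J)` on every smooth
algebra over a field** — proved locally on a cover `Spec B = ⋃ D(r)` by standard smooth `B_r`
(`Algebra.Smooth.exists_span_eq_top_isStandardSmooth`) and glued with `Diff^{≤ n}(I)·B_r = Diff^{≤ n}(I·B_r)`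
(`map_diffIdeal_eq_of_isLocalization`) and `Ideal.le_of_localization_maximal`.
[cite: EGAIV4, Thm. 16.11.2 and Prop. 16.8.6 (localization of Diff^n), Prop. 17.2.3]
[cite: VillamayorU2008ReesDiff, §3 (Leibniz on smooth schemes over a field)] -/
theorem diffIdeal_mul_le_of_smooth (K : Type u) [Field K] {B : Type v} [CommRing B] [Algebra K B]
    [Algebra.Smooth K B] (n : ℕ) (I J : Ideal B) :
    diffIdeal K n (I * J) ≤ ⨆ (i : ℕ) (_ : i ≤ n), diffIdeal K i I * diffIdeal K (n - i) J := by
  obtain ⟨s, hs, hstd⟩ := Algebra.Smooth.exists_span_eq_top_isStandardSmooth K B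
  refine Ideal.le_of_localization_maximal fun P hP => ?_
  -- a member of the cover avoiding `P`
  have hsP : ¬ s ⊆ P := fun h => hP.ne_top (top_le_iff.mp (hs ▸ Ideal.span_le.mpr h))
  obtain ⟨r, hrs, hrP⟩ := Set.not_subset.mp hsP
  haveI := hstd r hrs
  -- the inclusion in `B_r`
  have hr : (diffIdeal K n (I * J)).map (algebraMap B (Localization.Away r)) ≤
      (⨆ (i : ℕ) (_ : i ≤ n), diffIdeal K i I * diffIdeal K (n - i) J).map
        (algebraMap B (Localization.Away r)) := by
    rw [map_diffIdeal_eq_of_isLocalization K (Localization.Away r) (Submonoid.powers r) n, Ideal.map_mul,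
      Ideal.map_iSup]
    simp_rw [Ideal.map_iSup, Ideal.map_mul,
      map_diffIdeal_eq_of_isLocalization K (Localization.Away r) (Submonoid.powers r)]
    exact diffIdeal_mul_le_of_isStandardSmooth K n _ _
  -- transfer to `B_P` through `B_r → B_P`
  have hu : IsUnit (algebraMap B (Localization.AtPrime P) r) :=
    IsLocalization.map_units (Localization.AtPrime P) (⟨r, hrP⟩ : P.primeCompl)
  have hcomp : algebraMap B (Localization.AtPrime P) =
      (IsLocalization.Away.lift r hu).comp (algebraMap B (Localization.Away r)) :=
    (IsLocalization.Away.lift_comp r hu).symm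
  rw [hcomp, ← Ideal.map_map, ← Ideal.map_map]
  exact Ideal.map_mono hr

end Smooth

end Literature.AlgebraicGeometry.Resolution
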